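import Literature.Analysis.Fourier.FermionicPoissonSummation

/-!
# Route `KLProgramme`, crux K3 — engine-flow child (stmt-HubbardSuperconductivity-20437), stub (C) at `n = 0`, located item #22a «(C)-SCALE0-PT2»,
# §2a (M): truncation of a fermionic Matsubara sum to the engine's frequency WINDOW `-N ≤ n < N`, with an explicit rate

Cell gate-hubbard-kl, seat p1 g20 (supplier of #22a; SPEC v2 §2a (M) / the (β1) glue).  Companion of
`Literature.Analysis.Fourier.FermionicPoissonSummation` (the FULL series `(1/β) Σ_{n ∈ ℤ} e^{-iω_nτ} G(ω_n)`, `ω_n = (2n+1)π/β`, as an alternating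
sum over images, `fermionicMatsubaraSum_eq_tsum_images`).  The sharply cut-off Grassmann representation of the engine keeps only the `2N` frequencies
`ω_n`, `-N ≤ n < N` (`MatsubaraIdx N`; Salmhofer 1999 §4.2.4 (4.63), BGM 2006 §2.1 (2.6a)), and the propagator is the `N → ∞` limit of the window sums
(BGM (2.3)–(2.4)).  For a symbol with `‖G(ω_n)‖ ≤ A/ω_n²` at the DISCARDED frequencies — the shape of the OFF-SITE scale-`0` covariance, whose spatial factor
is `O(ω⁻²)` frequency by frequency (`…ScaleZeroCovarianceOffSiteWindow`) — the rate is explicit and uniform in `τ`: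

* `sum_range_one_div_odd_sq_shift_le`, `summable_one_div_odd_sq_shift`, `tsum_one_div_odd_sq_shift_le` — `Σ_{n ≥ N} (2n+1)⁻² ≤ 1/(4N)`
  (`(2n+1)² ≥ 4n(n+1)` and telescoping);
* **`norm_tsum_sub_sum_Ico_le_of_norm_le`** — generic form on `ℤ` in a complete normed group: if `‖F n‖ ≤ A/(2n+1)²` outside `[-N, N)` (`N ≥ 1`)
  then `F` is summable and `‖Σ'_n F n − Σ_{n ∈ [-N,N)} F n‖ ≤ A/(2N)`;
* **`norm_fermionicMatsubaraSum_sub_window_le`** — in the currency of `fermionicMatsubaraSum_eq_tsum_images`: absolute convergence and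
  `‖(1/β)Σ_{n∈ℤ} e^{-iω_nτ}G(ω_n) − (1/β)Σ_{-N≤n<N} e^{-iω_nτ}G(ω_n)‖ ≤ A·β/(2π²N)` for every real `τ` and `β > 0`
  (so (β1) of SPEC v2 = this ∘ `fermionicMatsubaraSum_eq_tsum_images`).

Proofs only; no definitions; nothing here asserts (C), any stub of 20437, K3 or superconductivity.  Tree search: `MatsubaraTruncationRemainder` /
`…Convergence` (one-mode sharp propagator: limits and uniform bounds, no rate), `MatsubaraSummationByParts` (decay in `x₀`), `HubbardTwoPointMatsubaraSeries`
(dominated convergence); a quantitative window bound was absent.  References: BGM 2006 §2.1 (2.3)–(2.6a) [cite: BenfattoGiulianiMastropietro2006];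
Salmhofer 1999 §4.2.4 (4.63)–(4.65) [cite: Salmhofer1999]; Fetter–Walecka 1971 Ch. 7 §25 [cite: FetterWalecka1971].
-/

noncomputable section

namespace Summit.HubbardSuperconductivity.HubbardSuperconductivity.Theorems.KLRegimeSplit

set_option linter.dupNamespace false -- summit = problem name (single-conjunct summit), D-0017

open Complex Filter Topology
open scoped Real

/-- `Σ_{m<K} 1/(2(m+N)+1)² ≤ 1/(4N) − 1/(4(K+N))` for `N ≥ 1` (`(2k+1)² ≥ 4k(k+1)` and telescoping). -/
theorem sum_range_one_div_odd_sq_shift_le {N : ℕ} (hN : 0 < N) (K : ℕ) :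
    ∑ m ∈ Finset.range K, 1 / (2 * ((m + N : ℕ) : ℝ) + 1) ^ 2 ≤ 1 / (4 * (N : ℝ)) - 1 / (4 * ((K + N : ℕ) : ℝ)) := by
  induction K with
  | zero => simp
  | succ K ih =>
    rw [Finset.sum_range_succ]
    have hk : (1 : ℝ) ≤ ((K + N : ℕ) : ℝ) := by exact_mod_cast (by omega : 1 ≤ K + N)
    have hstep : 1 / (2 * ((K + N : ℕ) : ℝ) + 1) ^ 2 ≤ 1 / (4 * ((K + N : ℕ) : ℝ)) - 1 / (4 * ((K + 1 + N : ℕ) : ℝ)) := by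
      have hcast : ((K + 1 + N : ℕ) : ℝ) = ((K + N : ℕ) : ℝ) + 1 := by push_cast; ring
      rw [hcast]
      set k : ℝ := ((K + N : ℕ) : ℝ) with hkdef
      rw [div_sub_div _ _ (by positivity) (by positivity), div_le_div_iff₀ (by positivity) (by positivity)]
      nlinarith
    calc _ ≤ (1 / (4 * (N : ℝ)) - 1 / (4 * ((K + N : ℕ) : ℝ))) + (1 / (4 * ((K + N : ℕ) : ℝ)) - 1 / (4 * ((K + 1 + N : ℕ) : ℝ))) :=
          add_le_add ih hstep
      _ = _ := by ring

/-- `m ↦ 1/(2(m+N)+1)²` is summable. -/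
theorem summable_one_div_odd_sq_shift (N : ℕ) : Summable fun m : ℕ => 1 / (2 * ((m + N : ℕ) : ℝ) + 1) ^ 2 := by
  have h1 : Summable fun m : ℕ => 1 / ((m : ℝ) + 1) ^ 2 := by
    have h := (summable_nat_add_iff 1).mpr (Real.summable_one_div_nat_pow.mpr one_lt_two)
    simpa using h
  refine Summable.of_nonneg_of_le (fun m => by positivity) (fun m => ?_) h1
  apply one_div_le_one_div_of_le (by positivity)
  have hm : (0 : ℝ) ≤ m := m.cast_nonneg
  have hN0 : (0 : ℝ) ≤ N := N.cast_nonneg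
  push_cast
  nlinarith

/-- `Σ_{m ≥ 0} 1/(2(m+N)+1)² ≤ 1/(4N)` for `N ≥ 1`. -/
theorem tsum_one_div_odd_sq_shift_le {N : ℕ} (hN : 0 < N) : ∑' m : ℕ, 1 / (2 * ((m + N : ℕ) : ℝ) + 1) ^ 2 ≤ 1 / (4 * (N : ℝ)) :=
  Real.tsum_le_of_sum_range_le (fun _ => by positivity) fun K =>
    (sum_range_one_div_odd_sq_shift_le hN K).trans (sub_le_self _ (by positivity))

/-- **Window truncation on `ℤ`**: if `‖F n‖ ≤ A/(2n+1)²` for every `n` OUTSIDE the window `[-N, N)` (`N ≥ 1`), then `F` is summable and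
`‖Σ'_n F(n) − Σ_{n ∈ [-N,N)} F(n)‖ ≤ A/(2N)`. -/
theorem norm_tsum_sub_sum_Ico_le_of_norm_le {E : Type*} [NormedAddCommGroup E] [CompleteSpace E] {F : ℤ → E} {N : ℕ} (hN : 0 < N) {A : ℝ}
    (hA : ∀ n : ℤ, (N : ℤ) ≤ n ∨ n < -N → ‖F n‖ ≤ A / (2 * (n : ℝ) + 1) ^ 2) :
    Summable F ∧ ‖∑' n, F n - ∑ n ∈ Finset.Ico (-(N : ℤ)) N, F n‖ ≤ A / (2 * N) := by
  classical
  set W : Finset ℤ := Finset.Ico (-(N : ℤ)) N with hW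
  have hmemW : ∀ n : ℤ, n ∉ W ↔ (N : ℤ) ≤ n ∨ n < -N := fun n => by
    simp only [hW, Finset.mem_Ico, not_and_or, not_le, not_lt]; tauto
  -- `A ≥ 0` (the tail is nonempty)
  have hA0 : 0 ≤ A := by
    have h := hA N (Or.inl le_rfl)
    have hpos : (0 : ℝ) < (2 * ((N : ℤ) : ℝ) + 1) ^ 2 := by positivity
    by_contra hneg
    have : A / (2 * ((N : ℤ) : ℝ) + 1) ^ 2 < 0 := div_neg_of_neg_of_pos (not_le.1 hneg) hpos
    linarith [norm_nonneg (F N)]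
  -- the tail family and its majorant
  set t : ℤ → E := fun n => if n ∈ W then 0 else F n with ht
  set g : ℤ → ℝ := fun n => if n ∈ W then 0 else A / (2 * (n : ℝ) + 1) ^ 2 with hg
  set T : ℝ := ∑' m : ℕ, 1 / (2 * ((m + N : ℕ) : ℝ) + 1) ^ 2 with hT
  have hTsum : HasSum (fun m : ℕ => A * (1 / (2 * ((m + N : ℕ) : ℝ) + 1) ^ 2)) (A * T) :=
    ((summable_one_div_odd_sq_shift N).hasSum).mul_left A
  have hg_nat : HasSum (fun m : ℕ => g m) (A * T) := by
    refine (hasSum_nat_add_iff' N).1 ?_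
    have hzero : ∑ i ∈ Finset.range N, g i = 0 := Finset.sum_eq_zero fun i hi => by
      have hi' := Finset.mem_range.1 hi
      have : (i : ℤ) ∈ W := by simp only [hW, Finset.mem_Ico]; omega
      simp only [hg]; rw [if_pos this]
    rw [hzero, sub_zero]
    refine hTsum.congr_fun fun m => ?_
    have hmem : ((m + N : ℕ) : ℤ) ∉ W := by simp only [hW, Finset.mem_Ico]; omega
    simp only [hg]
    rw [if_neg hmem]
    push_cast
    ring
  have hg_neg : HasSum (fun m : ℕ => g (-(m + 1 : ℤ))) (A * T) := by
    refine (hasSum_nat_add_iff' N).1 ?_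
    have hzero : ∑ i ∈ Finset.range N, g (-(i + 1 : ℤ)) = 0 := Finset.sum_eq_zero fun i hi => by
      have hi' := Finset.mem_range.1 hi
      have : (-(i + 1 : ℤ)) ∈ W := by simp only [hW, Finset.mem_Ico]; omega
      simp only [hg]; rw [if_pos this]
    rw [hzero, sub_zero]
    refine hTsum.congr_fun fun m => ?_
    have hmem : (-(((m + N : ℕ) : ℤ) + 1)) ∉ W := by simp only [hW, Finset.mem_Ico]; omega
    simp only [hg]
    rw [if_neg hmem]
    push_cast
    ring
  have hgsum : HasSum g (A * T + A * T) := HasSum.of_nat_of_neg_add_one hg_nat hg_neg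
  have hbound : ∀ n, ‖t n‖ ≤ g n := fun n => by
    by_cases hn : n ∈ W
    · simp only [ht, hg]; rw [if_pos hn, if_pos hn, norm_zero]
    · simp only [ht, hg]; rw [if_neg hn, if_neg hn]; exact hA n ((hmemW n).1 hn)
  have htsum : Summable t := .of_norm_bounded hgsum.summable hbound
  have hnorm : ‖∑' n, t n‖ ≤ A * T + A * T := tsum_of_norm_bounded hgsum hbound
  -- the window family (finite support) and the decomposition `F = w + t`
  set w : ℤ → E := fun n => if n ∈ W then F n else 0 with hw
  have hwsum : HasSum w (∑ n ∈ W, F n) := by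
    have h : HasSum w (∑ n ∈ W, w n) := hasSum_sum_of_ne_finset_zero fun n hn => by simp only [hw]; rw [if_neg hn]
    rwa [Finset.sum_congr rfl fun n hn => by simp only [hw]; rw [if_pos hn]] at h
  have hF : ∀ n, F n = w n + t n := fun n => by
    by_cases hn : n ∈ W
    · simp only [hw, ht]; rw [if_pos hn, if_pos hn, add_zero]
    · simp only [hw, ht]; rw [if_neg hn, if_neg hn, zero_add]
  have hFsum : HasSum F (∑ n ∈ W, F n + ∑' n, t n) :=
    (hwsum.add htsum.hasSum).congr_fun fun n => (hF n)
  refine ⟨hFsum.summable, ?_⟩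
  rw [hFsum.tsum_eq, add_sub_cancel_left]
  refine hnorm.trans ?_
  have hT4 : T ≤ 1 / (4 * (N : ℝ)) := tsum_one_div_odd_sq_shift_le hN
  have hN' : (0 : ℝ) < N := by exact_mod_cast hN
  calc A * T + A * T = 2 * (A * T) := by ring
    _ ≤ 2 * (A * (1 / (4 * (N : ℝ)))) := by gcongr
    _ = A / (2 * N) := by field_simp; ring

/-- **Window truncation of a fermionic Matsubara sum**: if `‖G(ω_n)‖ ≤ A/ω_n²` at the DISCARDED frequencies `ω_n = (2n+1)π/β`, `n ∉ [-N, N)`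
(`N ≥ 1`, `β > 0`), then the full series converges absolutely and, for every real `τ`,
`‖(1/β)Σ'_{n∈ℤ} e^{-iω_nτ}G(ω_n) − (1/β)Σ_{n∈[-N,N)} e^{-iω_nτ}G(ω_n)‖ ≤ A·β/(2π²N)` — the `2N`-frequency ultraviolet truncation of the Grassmann
representation converges to the full frequency sum at rate `O(β/N)` wherever the symbol is `O(ω⁻²)`. -/
theorem norm_fermionicMatsubaraSum_sub_window_le {G : ℝ → ℂ} {β : ℝ} (hβ : 0 < β) (τ : ℝ) {N : ℕ} (hN : 0 < N) {A : ℝ}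
    (hA : ∀ n : ℤ, (N : ℤ) ≤ n ∨ n < -N → ‖G ((2 * n + 1) * π / β)‖ ≤ A / ((2 * n + 1) * π / β) ^ 2) :
    Summable (fun n : ℤ => cexp (-(I * (((2 * n + 1) * π / β : ℝ) : ℂ) * τ)) * G ((2 * n + 1) * π / β)) ∧
    ‖((1 / β : ℝ) : ℂ) * ∑' n : ℤ, cexp (-(I * (((2 * n + 1) * π / β : ℝ) : ℂ) * τ)) * G ((2 * n + 1) * π / β) -
        ((1 / β : ℝ) : ℂ) * ∑ n ∈ Finset.Ico (-(N : ℤ)) N, cexp (-(I * (((2 * n + 1) * π / β : ℝ) : ℂ) * τ)) * G ((2 * n + 1) * π / β)‖ ≤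
      A * β / (2 * π ^ 2 * N) := by
  have hπ : 0 < π := Real.pi_pos
  have key := norm_tsum_sub_sum_Ico_le_of_norm_le
    (F := fun n : ℤ => cexp (-(I * (((2 * n + 1) * π / β : ℝ) : ℂ) * τ)) * G ((2 * n + 1) * π / β)) hN (A := A * β ^ 2 / π ^ 2)
    (fun n hn => by
      have hodd : (2 * (n : ℝ) + 1) ≠ 0 := by
        have : (2 * (n : ℝ) + 1) = ((2 * n + 1 : ℤ) : ℝ) := by push_cast; ring
        rw [this]; exact_mod_cast (by omega : (2 * n + 1 : ℤ) ≠ 0)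
      have hexp : ‖cexp (-(I * (((2 * n + 1) * π / β : ℝ) : ℂ) * τ))‖ = 1 := by
        rw [show -(I * (((2 * n + 1) * π / β : ℝ) : ℂ) * τ) = ((-((2 * n + 1) * π / β * τ) : ℝ) : ℂ) * I by push_cast; ring,
          Complex.norm_exp_ofReal_mul_I]
      rw [norm_mul, hexp, one_mul]
      refine (hA n hn).trans (le_of_eq ?_)
      field_simp)
  refine ⟨key.1, ?_⟩
  rw [← mul_sub, norm_mul, Complex.norm_real, Real.norm_of_nonneg (by positivity)]
  have hN' : (0 : ℝ) < N := by exact_mod_cast hN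
  calc 1 / β * ‖_‖ ≤ 1 / β * (A * β ^ 2 / π ^ 2 / (2 * N)) := mul_le_mul_of_nonneg_left key.2 (by positivity)
    _ = A * β / (2 * π ^ 2 * N) := by field_simp

end Summit.HubbardSuperconductivity.HubbardSuperconductivity.Theorems.KLRegimeSplit

end
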